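import Summits.CriticalPhenomena.PercolationContinuityZ3.Theorems.PercNearOneGluingNoHeavyLowerTailSahiHubTwoLevelOneLevelLaw
import Mathlib.Tactic.Linarith
import Mathlib.Tactic.Positivity
import Mathlib.Tactic.Ring
import HarnessLib

/-!
# `NoHeavyLowerTail` (crux stmt-CriticalPhenomena-4575), P2 — THE BIAS-FREE CROSS FORM IS NONNEGATIVE ON THE THEOREM-A FACE

Seat `prim-masterthm-p2`, gen 28 (memo `FROM-prim-masterthm-p2-g28-H-FREE-FLOW.md` §8(d); `--supports stmt-CriticalPhenomena-4575`).
No `sorry`, no named facts, standard axioms.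

On the THEOREM-A FACE (`f 0 z = f 1 z =: x_z`, `g 0 z = g 1 z =: y_z`: the sections do not depend on the c-index, i.e. the T₁(|C|=1) triple
degenerates to Sahi's two-level triple `x(z,a), y(z,b), h(z,a,b)`), the bias-free cross form of `…CrossForm` is `crossForm = 2·M` with
  `M = 2E[h₀x₀y₀] + 2E[h₁x₁y₁] − X₁E[h₀y₀] − Y₁E[h₀x₀] − X₀E[h₁y₁] − Y₀E[h₁x₁] − (X₁−X₀)(Y₁−Y₀)E[h₁]`
(`X_z, Y_z` the level means; all expectations under `wA ⊗ wB`).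

* **`crossForm_nonneg_thmA` — THEOREM M: `crossForm ≥ 0` on the Theorem-A face**, for FKG blocks, nested `[0,1]`-valued sections increasing
  in the hub level and `h₀ ≤ h₁` monotone.  PROOF (new; four lines on top of `…OneLevelLaw`): (1) fibre-Harris at level 0 with the LEVEL-1
  sections: `X₁E[h₀y₀] ≤ E[h₀x₁y₀]`, `Y₁E[h₀x₀] ≤ E[h₀x₀y₁]`; (2) the resulting level-0 integrand `2x₀y₀ − x₁y₀ − x₀y₁ = −y₀(x₁−x₀) − x₀(y₁−y₀)`
  is pointwise `≤ 0`, so multiplying it by `h₀ ≤ h₁` only helps: push it to level 1; (3) what remains at level 1 is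
  `E[h₁(K₁(x;y) − y₀(x₁−X₁) − x₀(y₁−Y₁))]`, the CORE-REDUCED one-level form of the nested pairs `(x₀ ≤ x₁)`, `(y₀ ≤ y₁)` — nonnegative by
  `mul_levelKernel_coreReduced_nonneg` (the explicit one-level certificate has core multipliers `≥ 1`).  Degenerate levels (`X₁ = 0` or `Y₁ = 0`)
  give `crossForm = 0`.
* **`twoLevel_nonneg_thmA`** — hence (splitting identity + one-level law) `twoLevel ≥ 0` on the Theorem-A face at every hub bias: a new,
  certificate-style proof of the two-level THEOREM A (`E₃(x,y,h) ≥ 0`, tree `sahiE_three_nonneg_sharedTwoPoint`) through its bias-free core.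
This is the Theorem-A-face case (`M_diag`) of conjecture I3 (`crossForm ≥ 0` in general), which remains OPEN.  Exact census of M: 0/12 000. [this work]
-/

noncomputable section

open scoped Classical

namespace Summit.CriticalPhenomena.PercolationContinuityZ3.Theorems

namespace SahiHubTwoLevel

open Finset Literature.Combinatorics.Sahi2008

variable {α β : Type} [Fintype α] [Fintype β]
  {wA : α → ℝ} {wB : β → ℝ} {wZ : Fin 2 → ℝ} {f : Fin 2 → Fin 2 → α → ℝ} {g : Fin 2 → Fin 2 → β → ℝ} {h : Fin 2 → α → β → ℝ}

/-- If every weighted section value `wA a · f i z a` vanishes, all level forms vanish. [this work] -/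
theorem levelForm_eq_zero_of_f_null (hnull : ∀ i z a, wA a * f i z a = 0) (z z' : Fin 2) :
    levelForm wA wB f g h z z' = 0 := by
  have hF : ∀ i z, Fm wA f i z = 0 := fun i z => sum_eq_zero fun a _ => hnull i z a
  have hY : ∀ i z b, Ysl wA f h i z b = 0 := fun i z b => sum_eq_zero fun a _ => by
    calc wA a * (f i z a * h z a b) = (wA a * f i z a) * h z a b := by ring
      _ = 0 := by rw [hnull, zero_mul]
  have hS : ∀ i j z, Sgy wA wB f g h i j z = 0 := fun i j z => sum_eq_zero fun b _ => by rw [hY]; ring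
  have hYb : ∀ i z, Ybar wA wB f h i z = 0 := fun i z => sum_eq_zero fun b _ => by rw [hY]; ring
  unfold levelForm
  rw [hS, hS, hYb, hYb, hF, hF]
  ring

/-- If every weighted section value `wB b · g j z b` vanishes, all level forms vanish. [this work] -/
theorem levelForm_eq_zero_of_g_null (hnull : ∀ j z b, wB b * g j z b = 0) (z z' : Fin 2) :
    levelForm wA wB f g h z z' = 0 := by
  have hG : ∀ j z, gm wB g j z = 0 := fun j z => sum_eq_zero fun b _ => hnull j z b
  have hS : ∀ i j z, Sgy wA wB f g h i j z = 0 := fun i j z => sum_eq_zero fun b _ => by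
    calc wB b * (g j z b * Ysl wA f h i z b) = (wB b * g j z b) * Ysl wA f h i z b := by ring
      _ = 0 := by rw [hnull, zero_mul]
  have hSg : ∀ j z, Sgh wA wB g h j z = 0 := fun j z => sum_eq_zero fun b _ => by
    calc wB b * (g j z b * Hsl wA h z b) = (wB b * g j z b) * Hsl wA h z b := by ring
      _ = 0 := by rw [hnull, zero_mul]
  unfold levelForm
  rw [hS, hS, hSg, hSg, hG, hG]
  ring

/-- `crossN = 0` when the `f`-sections are null. [this work] -/
theorem crossN_eq_zero_of_f_null (hnull : ∀ i z a, wA a * f i z a = 0) : crossN wA wB f g = 0 := by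
  have hF : ∀ i z, Fm wA f i z = 0 := fun i z => sum_eq_zero fun a _ => hnull i z a
  unfold crossN; rw [hF, hF, hF, hF]; ring

/-- `crossN = 0` when the `g`-sections are null. [this work] -/
theorem crossN_eq_zero_of_g_null (hnull : ∀ j z b, wB b * g j z b = 0) : crossN wA wB f g = 0 := by
  have hG : ∀ j z, gm wB g j z = 0 := fun j z => sum_eq_zero fun b _ => hnull j z b
  unfold crossN; rw [hG, hG, hG, hG]; ring

/-- `Hb` as a double weighted sum. [this work] -/
theorem Hb_eq_sum2 (z : Fin 2) : Hb wA wB h z = ∑ b, wB b * ∑ a, wA a * h z a b := rfl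

/-- **THEOREM M — the bias-free cross form is nonnegative on the Theorem-A face.** [this work] -/
theorem crossForm_nonneg_thmA [DistribLattice α] [DistribLattice β] (hA : IsFKGMeasure wA) (hB : IsFKGMeasure wB)
    (hfc : ∀ z a, f 1 z a = f 0 z a) (hgc : ∀ z b, g 1 z b = g 0 z b)
    (hf0 : ∀ i z a, 0 ≤ f i z a) (hf1 : ∀ i z a, f i z a ≤ 1) (hfa : ∀ i z, Monotone (f i z)) (hfz : ∀ i a, f i 0 a ≤ f i 1 a)
    (hg0 : ∀ j z b, 0 ≤ g j z b) (hg1 : ∀ j z b, g j z b ≤ 1) (hgb : ∀ j z, Monotone (g j z)) (hgz : ∀ j b, g j 0 b ≤ g j 1 b)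
    (hh0 : ∀ z a b, 0 ≤ h z a b) (hha : ∀ z b, Monotone (fun a => h z a b)) (hhb : ∀ z a, Monotone (h z a))
    (hhz : ∀ a b, h 0 a b ≤ h 1 a b) :
    0 ≤ crossForm wA wB f g h := by
  have hA0 := hA.nonneg; have hB0 := hB.nonneg
  -- means on the face
  have hFm : ∀ z, Fm wA f 1 z = Fm wA f 0 z := fun z => sum_congr rfl fun a _ => by rw [hfc]
  have hgm : ∀ z, gm wB g 1 z = gm wB g 0 z := fun z => sum_congr rfl fun b _ => by rw [hgc]
  -- degenerate cases: X₁ = 0 or Y₁ = 0 force crossForm = 0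
  by_cases hX : Fm wA f 0 1 = 0
  · have h1 : ∀ a, wA a * f 0 1 a = 0 :=
      (sum_eq_zero_iff_of_nonneg fun a _ => mul_nonneg (hA0 a) (hf0 0 1 a)).1 hX |> fun H a => H a (mem_univ a)
    have hnull : ∀ i z a, wA a * f i z a = 0 := by
      intro i z a
      have e1 : f i z a = f 0 z a := by fin_cases i; exacts [rfl, hfc z a]
      have e2 : f 0 z a ≤ f 0 1 a := by fin_cases z; exacts [hfz 0 a, le_refl _]
      have hle : f i z a ≤ f 0 1 a := by rw [e1]; exact e2
      have := mul_le_mul_of_nonneg_left hle (hA0 a)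
      have hge : 0 ≤ wA a * f i z a := mul_nonneg (hA0 a) (hf0 i z a)
      linarith [h1 a]
    unfold crossForm
    rw [levelForm_eq_zero_of_f_null hnull, levelForm_eq_zero_of_f_null hnull, crossN_eq_zero_of_f_null hnull]
    simp
  by_cases hY : gm wB g 0 1 = 0
  · have h1 : ∀ b, wB b * g 0 1 b = 0 :=
      (sum_eq_zero_iff_of_nonneg fun b _ => mul_nonneg (hB0 b) (hg0 0 1 b)).1 hY |> fun H b => H b (mem_univ b)
    have hnull : ∀ j z b, wB b * g j z b = 0 := by
      intro j z b
      have e1 : g j z b = g 0 z b := by fin_cases j; exacts [rfl, hgc z b]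
      have e2 : g 0 z b ≤ g 0 1 b := by fin_cases z; exacts [hgz 0 b, le_refl _]
      have hle : g j z b ≤ g 0 1 b := by rw [e1]; exact e2
      have := mul_le_mul_of_nonneg_left hle (hB0 b)
      have hge : 0 ≤ wB b * g j z b := mul_nonneg (hB0 b) (hg0 j z b)
      linarith [h1 b]
    unfold crossForm
    rw [levelForm_eq_zero_of_g_null hnull, levelForm_eq_zero_of_g_null hnull, crossN_eq_zero_of_g_null hnull]
    simp
  have hXp : 0 < Fm wA f 0 1 := lt_of_le_of_ne (Fm_nonneg hA0 hf0 0 1) (Ne.symm hX)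
  have hYp : 0 < gm wB g 0 1 := lt_of_le_of_ne (gm_nonneg hB0 hg0 0 1) (Ne.symm hY)
  -- kernel form of crossForm: Σ_b wB Σ_a wA [h0·K(0;1) + (h1·K(1;0) − h1·crossN)]
  have eC : crossForm wA wB f g h = ∑ b, wB b * ∑ a, wA a *
      (h 0 a b * levelKernel wA wB f g 0 1 a b + (h 1 a b * levelKernel wA wB f g 1 0 a b - h 1 a b * crossN wA wB f g)) := by
    have e4 : (∑ b, wB b * ∑ a, wA a *
        (h 0 a b * levelKernel wA wB f g 0 1 a b + (h 1 a b * levelKernel wA wB f g 1 0 a b - h 1 a b * crossN wA wB f g))) =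
        (∑ b, wB b * ∑ a, wA a * (h 0 a b * levelKernel wA wB f g 0 1 a b))
          + ((∑ b, wB b * ∑ a, wA a * (h 1 a b * levelKernel wA wB f g 1 0 a b))
          + ∑ b, wB b * ∑ a, wA a * ((-crossN wA wB f g) * h 1 a b)) := by
      rw [← sum2_add, ← sum2_add]
      exact sum_congr rfl fun b _ => by congr 1; exact sum_congr rfl fun a _ => by ring
    rw [e4, sum2_smul, ← Hb_eq_sum2 (wA := wA) (wB := wB) (h := h) 1,
      ← levelForm_eq_kernel (wA := wA) (wB := wB) (f := f) (g := g) (h := h) 0 1,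
      ← levelForm_eq_kernel (wA := wA) (wB := wB) (f := f) (g := g) (h := h) 1 0]
    unfold crossForm; ring
  -- face values of the kernels
  have eK0 : ∀ a b, levelKernel wA wB f g 0 1 a b =
      2 * (2 * (f 0 0 a * g 0 0 b) - Fm wA f 0 1 * g 0 0 b - gm wB g 0 1 * f 0 0 a) := fun a b => by
    unfold levelKernel; rw [hfc, hgc, hFm, hgm]; ring
  have eK1 : ∀ a b, levelKernel wA wB f g 1 0 a b - crossN wA wB f g =
      2 * (2 * (f 0 1 a * g 0 1 b) - Fm wA f 0 0 * g 0 1 b - gm wB g 0 0 * f 0 1 a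
        - (Fm wA f 0 1 - Fm wA f 0 0) * (gm wB g 0 1 - gm wB g 0 0)) := fun a b => by
    unfold levelKernel crossN; rw [hfc, hgc, hFm, hgm, hFm, hgm]; ring
  -- STEP 1: split the level-0 integrand into a pushable part and two level-0 Harris terms with level-1 sections
  have epoint : ∀ a b, h 0 a b * levelKernel wA wB f g 0 1 a b + (h 1 a b * levelKernel wA wB f g 1 0 a b - h 1 a b * crossN wA wB f g) =
      2 * (h 0 a b * (2 * (f 0 0 a * g 0 0 b) - f 0 1 a * g 0 0 b - f 0 0 a * g 0 1 b))
      + (2 * (h 0 a b * (g 0 0 b * (f 0 1 a - Fm wA f 0 1))) + (2 * (h 0 a b * (f 0 0 a * (g 0 1 b - gm wB g 0 1)))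
      + 2 * (h 1 a b * (2 * (f 0 1 a * g 0 1 b) - Fm wA f 0 0 * g 0 1 b - gm wB g 0 0 * f 0 1 a
          - (Fm wA f 0 1 - Fm wA f 0 0) * (gm wB g 0 1 - gm wB g 0 0))))) := fun a b => by
    have e1 : h 1 a b * levelKernel wA wB f g 1 0 a b - h 1 a b * crossN wA wB f g =
        h 1 a b * (levelKernel wA wB f g 1 0 a b - crossN wA wB f g) := by ring
    rw [e1, eK0, eK1]; ring
  -- STEP 2: the pushable part is ≤ 0 pointwise, so h₀ ≤ h₁ only helps
  have push : ∀ a b, h 1 a b * (2 * (f 0 0 a * g 0 0 b) - f 0 1 a * g 0 0 b - f 0 0 a * g 0 1 b) ≤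
      h 0 a b * (2 * (f 0 0 a * g 0 0 b) - f 0 1 a * g 0 0 b - f 0 0 a * g 0 1 b) := fun a b => by
    have hneg : 2 * (f 0 0 a * g 0 0 b) - f 0 1 a * g 0 0 b - f 0 0 a * g 0 1 b ≤ 0 := by
      have := mul_nonneg (hg0 0 0 b) (sub_nonneg.2 (hfz 0 a))
      have := mul_nonneg (hf0 0 0 a) (sub_nonneg.2 (hgz 0 b))
      nlinarith
    exact mul_le_mul_of_nonpos_right (hhz a b) hneg
  -- STEP 3: what remains at level 1 is the core-reduced one-level kernel of the nested pairs (x₀,x₁) = (f 0 0, f 0 1), (y₀,y₁)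
  have hcore := mul_levelKernel_coreReduced_nonneg (f := fun i (_ : Fin 2) a => f 0 i a) (g := fun j (_ : Fin 2) b => g 0 j b)
    (h := fun (_ : Fin 2) a b => h 1 a b) hA hB (fun i z a => hf0 0 i a) (fun i z a => hf1 0 i a)
    (fun z a => hfz 0 a) (fun i z => hfa 0 i) (fun j z b => hg0 0 j b) (fun j z b => hg1 0 j b) (fun z b => hgz 0 b) (fun j z => hgb 0 j)
    (fun z a b => hh0 1 a b) (fun z b => hha 1 b) (fun z a => hhb 1 a) 0
  have eXm : Fm wA (fun i (_ : Fin 2) a => f 0 i a) 1 0 = Fm wA f 0 1 := rfl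
  have eYm : gm wB (fun j (_ : Fin 2) b => g 0 j b) 1 0 = gm wB g 0 1 := rfl
  rw [eXm, eYm] at hcore
  -- the level-1 lower bound for crossForm
  set D : α → β → ℝ := fun a b => h 1 a b * (2 * (f 0 0 a * g 0 0 b) - f 0 1 a * g 0 0 b - f 0 0 a * g 0 1 b)
      + h 1 a b * (2 * (f 0 1 a * g 0 1 b) - Fm wA f 0 0 * g 0 1 b - gm wB g 0 0 * f 0 1 a
          - (Fm wA f 0 1 - Fm wA f 0 0) * (gm wB g 0 1 - gm wB g 0 0)) with hD
  have hcore' : 0 ≤ ∑ b, wB b * ∑ a, wA a * (Fm wA f 0 1 * gm wB g 0 1 * D a b) := by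
    have e : ∀ a b, Fm wA f 0 1 * gm wB g 0 1 * D a b =
        (fun (_ : Fin 2) (a : α) (b : β) => h 1 a b) 0 a b *
          (Fm wA f 0 1 * gm wB g 0 1 * levelKernel wA wB (fun i (_ : Fin 2) a => f 0 i a) (fun j (_ : Fin 2) b => g 0 j b) 0 0 a b
            - Fm wA f 0 1 * gm wB g 0 1 * ((fun j (_ : Fin 2) b => g 0 j b) 0 0 b *
                ((fun i (_ : Fin 2) a => f 0 i a) 1 0 a - Fm wA f 0 1))
            - Fm wA f 0 1 * gm wB g 0 1 * ((fun i (_ : Fin 2) a => f 0 i a) 0 0 a *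
                ((fun j (_ : Fin 2) b => g 0 j b) 1 0 b - gm wB g 0 1))) := fun a b => by
      simp only [hD, levelKernel, Fm, gm]; ring
    simp only [e]; exact hcore
  have hlow : 2 * (∑ b, wB b * ∑ a, wA a * D a b) ≤ crossForm wA wB f g h := by
    rw [eC]
    simp only [epoint, sum2_add]
    have t1 : 0 ≤ ∑ b, wB b * ∑ a, wA a * (2 * (h 0 a b * (g 0 0 b * (f 0 1 a - Fm wA f 0 1)))) := by
      rw [sum2_smul]; refine mul_nonneg (by norm_num) ?_
      simp only [sum_a_pull]
      exact harrisA_nonneg hA hB0 hf0 hfa hh0 hha (fun b => hg0 0 0 b) 0 0 1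
    have t2 : 0 ≤ ∑ b, wB b * ∑ a, wA a * (2 * (h 0 a b * (f 0 0 a * (g 0 1 b - gm wB g 0 1)))) := by
      rw [sum2_smul]; refine mul_nonneg (by norm_num) ?_
      rw [sum_swap]; simp only [sum_b_pull]
      exact harrisB_nonneg hB hA0 hg0 hgb hh0 hhb (fun a => hf0 0 0 a) 0 0 1
    have t3 : 2 * (∑ b, wB b * ∑ a, wA a * D a b) ≤
        (∑ b, wB b * ∑ a, wA a * (2 * (h 0 a b * (2 * (f 0 0 a * g 0 0 b) - f 0 1 a * g 0 0 b - f 0 0 a * g 0 1 b)))) +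
        ∑ b, wB b * ∑ a, wA a * (2 * (h 1 a b * (2 * (f 0 1 a * g 0 1 b) - Fm wA f 0 0 * g 0 1 b - gm wB g 0 0 * f 0 1 a
          - (Fm wA f 0 1 - Fm wA f 0 0) * (gm wB g 0 1 - gm wB g 0 0)))) := by
      rw [← sum2_add, ← sum2_smul]
      refine sum_le_sum fun b _ => mul_le_mul_of_nonneg_left (sum_le_sum fun a _ => mul_le_mul_of_nonneg_left ?_ (hA0 a)) (hB0 b)
      simp only [hD]
      have := push a b
      linarith
    linarith
  have hprod : 0 ≤ Fm wA f 0 1 * gm wB g 0 1 * crossForm wA wB f g h := by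
    have h2 := mul_le_mul_of_nonneg_left hlow (le_of_lt (mul_pos hXp hYp))
    have e : Fm wA f 0 1 * gm wB g 0 1 * (2 * ∑ b, wB b * ∑ a, wA a * D a b) =
        2 * ∑ b, wB b * ∑ a, wA a * (Fm wA f 0 1 * gm wB g 0 1 * D a b) := by
      rw [sum2_smul]; ring
    rw [e] at h2
    linarith
  by_contra hneg
  have := mul_neg_of_pos_of_neg (mul_pos hXp hYp) (not_le.mp hneg)
  linarith

/-- **THEOREM A through its bias-free core.**  On the Theorem-A face the hub two-level form is nonnegative at every hub bias
(splitting identity + one-level law + Theorem M).  Via `sahiE_three_nonneg_T1C1_of_twoLevel_nonneg` this is Sahi's `E₃(x,y,h) ≥ 0` for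
`x(z,a), y(z,b), h(z,a,b)` — already in the tree as `sahiE_three_nonneg_sharedTwoPoint`; the present route is new. [this work] -/
theorem twoLevel_nonneg_thmA [DistribLattice α] [DistribLattice β] (hA : IsFKGMeasure wA) (hB : IsFKGMeasure wB)
    (hZ0 : 0 ≤ wZ 0) (hZ1 : 0 ≤ wZ 1) (hZ : wZ 0 + wZ 1 = 1)
    (hfc : ∀ z a, f 1 z a = f 0 z a) (hgc : ∀ z b, g 1 z b = g 0 z b)
    (hf0 : ∀ i z a, 0 ≤ f i z a) (hf1 : ∀ i z a, f i z a ≤ 1) (hfa : ∀ i z, Monotone (f i z)) (hfz : ∀ i a, f i 0 a ≤ f i 1 a)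
    (hg0 : ∀ j z b, 0 ≤ g j z b) (hg1 : ∀ j z b, g j z b ≤ 1) (hgb : ∀ j z, Monotone (g j z)) (hgz : ∀ j b, g j 0 b ≤ g j 1 b)
    (hh0 : ∀ z a b, 0 ≤ h z a b) (hha : ∀ z b, Monotone (fun a => h z a b)) (hhb : ∀ z a, Monotone (h z a))
    (hhz : ∀ a b, h 0 a b ≤ h 1 a b) :
    0 ≤ twoLevel wA wB wZ f g h :=
  twoLevel_nonneg_of_crossForm_nonneg' hA hB hZ0 hZ1 hZ hf0 hf1 (fun z a => by rw [hfc]) hfa hfz hg0 hg1 (fun z b => by rw [hgc]) hgb hgz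
    hh0 hha hhb hhz (crossForm_nonneg_thmA hA hB hfc hgc hf0 hf1 hfa hfz hg0 hg1 hgb hgz hh0 hha hhb hhz)

end SahiHubTwoLevel

end Summit.CriticalPhenomena.PercolationContinuityZ3.Theorems
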